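import Mathlib
import HarnessLib

/-!
# Route `KLProgramme` — crux K3 ENGINE (stmt-…-20437) stub (b) conj. 2 «(c-D)² FAMILY TELESCOPE», brick (D2b-rest, part 3): NORMALISING a multiplier
# by its amplitude — `Mf = A⁻¹•Gs` has sup `≤ 1`, the same support, and differences divided by `A`

Cell `gate-hubbard-kl`, seat hubbard-kl-k3c3-p2 (g10); F1-DESIGN §7 (viii).  The pair lemma `slicePairWt_charSum_l1_le` wants a multiplier of sup `≤ 1`;
the increment pair `Gs^Δ` has sup `≤ A = C₁W₀` (`bgmFatIncrPair_data`) and differences `≤ 𝔅`-Leibniz bounds; the assembler feeds `Mf := A⁻¹•Gs^Δ` and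
multiplies the conclusion by `A`.  Generic over the step group and real scalars acting on `ℂ`-valued functions:

* `fwdDiff_iter_const_smul_real` — `Δ_h^k (c•f) = c•Δ_h^k f`;
* **`normalisedMultiplier_data`** — for `0 < A` and `‖Gs‖ ≤ A`: `‖A⁻¹•Gs‖ ≤ 1`, `(A⁻¹•Gs) q ≠ 0 ↔ Gs q ≠ 0`, and
  `‖Δ_h^k Gs (q)‖ ≤ D ⇒ ‖Δ_h^k (A⁻¹•Gs)(q)‖ ≤ D/A`.

Pure algebra; no definitions, no sorry.  Nothing asserts superconductivity. [cite: BenfattoGiulianiMastropietro2006, §2.5 (2.52)]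
-/

noncomputable section

namespace Summit.HubbardSuperconductivity.HubbardSuperconductivity.Theorems.TorusFourierL2

set_option linter.dupNamespace false -- summit = problem name (single-conjunct summit), D-0017

/-- `Δ_h^k (c • f) = c • Δ_h^k f` for a real scalar on `ℂ`-valued functions. [cite: BenfattoGiulianiMastropietro2006, §2.5 (2.52)] -/
theorem fwdDiff_iter_const_smul_real {Mg : Type*} [AddCommMonoid Mg] (h : Mg) (c : ℝ) (f : Mg → ℂ) (k : ℕ) :
    (fwdDiff h)^[k] (c • f) = c • (fwdDiff h)^[k] f := by
  induction k with
  | zero => rfl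
  | succ k ih => rw [Function.iterate_succ_apply', ih, fwdDiff_const_smul, Function.iterate_succ_apply']

/-- **Normalising a multiplier by its amplitude**: for `0 < A` and `‖Gs q‖ ≤ A` everywhere, `Mf := A⁻¹ • Gs` has `‖Mf q‖ ≤ 1`, the same support, and every
iterated difference bound of `Gs` divided by `A`. [cite: BenfattoGiulianiMastropietro2006, §2.5 (2.52)] -/
theorem normalisedMultiplier_data {Mg : Type*} [AddCommMonoid Mg] (Gs : Mg → ℂ) {A : ℝ} (hA : 0 < A) (hsup : ∀ q, ‖Gs q‖ ≤ A) :
    (∀ q, ‖(A⁻¹ • Gs) q‖ ≤ 1) ∧ (∀ q, (A⁻¹ • Gs) q ≠ 0 ↔ Gs q ≠ 0) ∧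
    (∀ (h : Mg) (k : ℕ) (q : Mg) (D : ℝ), ‖((fwdDiff h)^[k] Gs) q‖ ≤ D → ‖((fwdDiff h)^[k] (A⁻¹ • Gs)) q‖ ≤ D / A) := by
  have hAinv : 0 < A⁻¹ := inv_pos.2 hA
  refine ⟨fun q => ?_, fun q => ?_, fun h k q D hD => ?_⟩
  · rw [Pi.smul_apply, norm_smul, Real.norm_eq_abs, abs_of_pos hAinv]
    calc A⁻¹ * ‖Gs q‖ ≤ A⁻¹ * A := mul_le_mul_of_nonneg_left (hsup q) hAinv.le
      _ = 1 := inv_mul_cancel₀ hA.ne'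
  · rw [Pi.smul_apply, smul_ne_zero_iff]
    exact ⟨fun h => h.2, fun h => ⟨hAinv.ne', h⟩⟩
  · rw [fwdDiff_iter_const_smul_real, Pi.smul_apply, norm_smul, Real.norm_eq_abs, abs_of_pos hAinv, div_eq_inv_mul]
    exact mul_le_mul_of_nonneg_left hD hAinv.le

end Summit.HubbardSuperconductivity.HubbardSuperconductivity.Theorems.TorusFourierL2

end
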